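import Summits.MatrixMultiplication.OmegaCensus.DominoZpZpStructSixCore
import HarnessLib

/-!
# Structural cover argument for part size `6` on `ZMod p × ZMod p` WITHOUT the pigeonhole (every odd prime `p`): the core

ω-census `pub-omega`, family (b3), seat pub-omega-group gen 25.  Framing: lottery ticket; floor = certified bounds/negative
ranges.  VALUE: removes the hypothesis `p + 1 < 15` of `DominoZpZpStructSixCore.exists_goodS`, so that the structural part-`6`
route reaches the OPEN census cells `(1,6,16)@289` (`A = ℤ₁₇²`) and `(1,6,20)@361` (`A = ℤ₁₉²`); NOT progress on ω.

The part-`6` core of gen 23 pins a configuration of six points by two PARALLEL pairs, which exist by pigeonhole only for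
`p ≤ 13` (`15 > p + 1` directions).  Here the remaining case — six distinct points whose fifteen pair directions are pairwise
distinct — is pinned as well: collapsing the pair `{0,3}` gives values `x` with `x₀ = x₃` and NO other coincidence, collapsing
`{0,2}` gives `y` with `y₀ = y₂` and no other coincidence (a further coincidence would be a second pair parallel to the first), and
a third finite PAIR PROPERTY `h3c` (decided per prime over these very restricted arrangements — both keys then have the shape
`2+1+1+1+1`; the index pairs `{0,3}`, `{0,2}` match the arrangement generators `arr6Y3`, `arr6Y2` of
`DominoZpZpStructSixCheck.lean`) supplies a good pair exactly as `h3a`/`h3b` do (`goodS_of_pair_data`).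

* `goodS_of_distinct` — the distinct-directions case from `h3c`;
* `exists_goodS_wide` — the structural core for EVERY `p`: hypotheses `hE1`, `hE2`, `h3a`, `h3b` as in `exists_goodS`, plus `h3c`.

Exact desk check (pub-omega-group-g25 `code/s6w_check.py`, `s6w_checkab.py`): at `p = 17` the distinct-directions family has
`1 440 000` scaling-normalised configurations, at `p = 19` `1 166 400`, every one with `≥ 3` good pairs; families `a`, `b` likewise `0` bad.
-/

namespace Summit.MatrixMultiplication.OmegaCensus

open Finset

namespace ZpZpDomino

section Core

variable {p : ℕ} [Fact p.Prime]

omit [Fact p.Prime] in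
/-- Transport of the goal along a relabelling of the points. [folklore] -/
private theorem goal_of_perm_w {E : List (List ℕ)} {u : Fin 6 → ZMod p × ZMod p} (τ : Equiv.Perm (Fin 6))
    (h : ∃ j < p + 1, ∃ σ : Equiv.Perm (Fin 6), lineDir p j (u (τ (σ 0))) = lineDir p j (u (τ (σ 1))) ∧
      key6 (fun i => lineDir p j (u (τ (σ i)))) ∉ E) :
    ∃ j < p + 1, ∃ σ : Equiv.Perm (Fin 6), lineDir p j (u (σ 0)) = lineDir p j (u (σ 1)) ∧
      key6 (fun i => lineDir p j (u (σ i))) ∉ E := by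
  obtain ⟨j, hj, σ, h1, h2⟩ := h
  exact ⟨j, hj, σ.trans τ, h1, h2⟩

/-- Index bookkeeping for two distinct pairs `i < j`, `k < l`. [folklore] -/
private theorem pairs_overlap_w : ∀ i j k l : Fin 6, i < j → k < l → (i, j) ≠ (k, l) →
    (i ≠ k ∧ i ≠ l ∧ j ≠ k ∧ j ≠ l) ∨ j = k ∨ i = k ∨ i = l ∨ j = l := by decide

/-- **The distinct-directions case.**  Six distinct points, no two distinct index pairs with parallel differences: the collapse
of `{0,3}` (`x`, only coincidence `x₀ = x₃`) and of `{0,2}` (`y`, only coincidence `y₀ = y₂`) are either good themselves or the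
pair property `h3c` pins a good pair. [folklore] -/
theorem goodS_of_distinct {E : List (List ℕ)} (hE2 : ∀ k ∈ E, ∀ κ : ℕ, 1 ≤ κ → κ < p → scaleVec p κ k ∈ E)
    (h3c : ∀ x y : Fin 6 → ZMod p, x 0 = x 3 →
      (∀ a b : Fin 6, a ≠ b → x a = x b → (a = 0 ∧ b = 3) ∨ (a = 3 ∧ b = 0)) → key6 x ∈ E → y 0 = y 2 →
      (∀ a b : Fin 6, a ≠ b → y a = y b → (a = 0 ∧ b = 2) ∨ (a = 2 ∧ b = 0)) → key6 y ∈ E →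
      ∃ i j : Fin 6, (x i, y i) ≠ (x j, y j) ∧ key6 (fun k => (y i - y j) * x k - (x i - x j) * y k) ∉ E)
    (u : Fin 6 → ZMod p × ZMod p) (hinj : Function.Injective u)
    (hnp : ∀ q q' : {q : Fin 6 × Fin 6 // q.1 < q.2}, q ≠ q' →
      lmap (u q.1.1 - u q.1.2).2 (-(u q.1.1 - u q.1.2).1) (u q'.1.1 - u q'.1.2) ≠ 0) :
    ∃ j < p + 1, ∃ σ : Equiv.Perm (Fin 6), lineDir p j (u (σ 0)) = lineDir p j (u (σ 1)) ∧
      key6 (fun i => lineDir p j (u (σ i))) ∉ E := by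
  -- the no-parallel-pairs hypothesis for the pairs `{0,1}` and `{0,2}` in a symmetric form
  have hsep : ∀ (c d : Fin 6) (hcd : c < d) (a b : Fin 6), a ≠ b →
      lmap (u c - u d).2 (-(u c - u d).1) (u a - u b) = 0 → (a = c ∧ b = d) ∨ (a = d ∧ b = c) := by
    intro c d hcd a b hab h0
    rcases lt_or_gt_of_ne hab with hlt | hlt
    · left
      by_contra hne
      refine hnp ⟨(c, d), hcd⟩ ⟨(a, b), hlt⟩ (fun h => hne ?_) h0
      obtain ⟨h1, h2⟩ := Prod.mk.inj (congrArg Subtype.val h)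
      exact ⟨h1.symm, h2.symm⟩
    · right
      by_contra hne
      have h0' : lmap (u c - u d).2 (-(u c - u d).1) (u b - u a) = 0 := by
        rw [← neg_sub (u a) (u b), map_neg, h0, neg_zero]
      refine hnp ⟨(c, d), hcd⟩ ⟨(b, a), hlt⟩ (fun h => hne ?_) h0'
      obtain ⟨h1, h2⟩ := Prod.mk.inj (congrArg Subtype.val h)
      exact ⟨h2.symm, h1.symm⟩
  have h03ne : u 0 ≠ u 3 := fun h => absurd (hinj h) (by decide)
  set c₁ : ZMod p := (u 0 - u 3).2 with hc₁
  set c₂ : ZMod p := -(u 0 - u 3).1 with hc₂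
  have hc : c₁ ≠ 0 ∨ c₂ ≠ 0 := by
    by_contra h; push Not at h
    exact h03ne (sub_eq_zero.1 (Prod.ext (neg_eq_zero.1 h.2) h.1))
  set x : Fin 6 → ZMod p := fun k => lmap c₁ c₂ (u k) with hx
  have h03 : x 0 = x 3 := by
    have : lmap c₁ c₂ (u 0 - u 3) = 0 := by rw [lmap_apply]; ring
    rwa [map_sub, sub_eq_zero] at this
  have hxsep : ∀ a b : Fin 6, a ≠ b → x a = x b → (a = 0 ∧ b = 3) ∨ (a = 3 ∧ b = 0) := by
    intro a b hab e
    have h0 : lmap c₁ c₂ (u a - u b) = 0 := by rw [map_sub, sub_eq_zero]; exact e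
    exact hsep 0 3 (by decide) a b hab h0
  by_cases hxE : key6 x ∈ E
  swap
  · obtain ⟨e0, e3⟩ := pairPerm6_apply 0 3 (by decide)
    refine good_of_lmap6 hE2 u c₁ c₂ hc (pairPerm6 0 3) ?_ hxE
    rw [e0, e3]; exact h03
  have hx2 : x 2 ≠ x 0 := by
    intro e
    rcases hxsep 2 0 (by decide) e with ⟨h, -⟩ | ⟨h, -⟩ <;> exact absurd h (by decide)
  set w : ZMod p × ZMod p := u 0 - u 2 with hw
  have hD : c₁ * w.1 + c₂ * w.2 ≠ 0 := by
    intro h; apply hx2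
    have : lmap c₁ c₂ (u 0) - lmap c₁ c₂ (u 2) = 0 := by rw [← map_sub, ← hw, lmap_apply]; exact h
    exact (sub_eq_zero.1 this).symm
  set y : Fin 6 → ZMod p := fun k => lmap w.2 (-w.1) (u k) with hy
  have hy02 : y 0 = y 2 := by
    have : lmap w.2 (-w.1) (u 0) - lmap w.2 (-w.1) (u 2) = 0 := by rw [← map_sub, ← hw, lmap_apply]; ring
    exact sub_eq_zero.1 this
  have hysep : ∀ a b : Fin 6, a ≠ b → y a = y b → (a = 0 ∧ b = 2) ∨ (a = 2 ∧ b = 0) := by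
    intro a b hab e
    have h0 : lmap w.2 (-w.1) (u a - u b) = 0 := by rw [map_sub, sub_eq_zero]; exact e
    exact hsep 0 2 (by decide) a b hab h0
  have hcw : w.2 ≠ 0 ∨ -w.1 ≠ 0 := by
    by_contra h; push Not at h
    apply hD; rw [neg_eq_zero.1 h.2, h.1]; ring
  by_cases hyE : key6 y ∈ E
  swap
  · obtain ⟨h0, h2⟩ := pairPerm6_apply 0 2 (by decide)
    refine good_of_lmap6 hE2 u w.2 (-w.1) hcw (pairPerm6 0 2) ?_ hyE
    rw [h0, h2]; exact hy02
  obtain ⟨i, j, hne, hm⟩ := h3c x y h03 hxsep hxE hy02 hysep hyE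
  exact goodS_of_pair_data hE2 u c₁ c₂ w hD i j hne hm

/-- **The structural core for part `6`, every odd prime `p`** (no pigeonhole): hypotheses `hE1`, `hE2`, `h3a`, `h3b` of
`exists_goodS` and the distinct-directions pair property `h3c`. [folklore] -/
theorem exists_goodS_wide (E : List (List ℕ)) (hE1 : ∀ k ∈ E, ∀ x ∈ k, x ≤ 3)
    (hE2 : ∀ k ∈ E, ∀ κ : ℕ, 1 ≤ κ → κ < p → scaleVec p κ k ∈ E)
    (h3a : ∀ x y : Fin 6 → ZMod p, x 0 = x 1 → x 1 = x 2 → key6 x ∈ E → y 0 = y 3 → key6 y ∈ E →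
      ∃ i j : Fin 6, (x i, y i) ≠ (x j, y j) ∧ key6 (fun k => (y i - y j) * x k - (x i - x j) * y k) ∉ E)
    (h3b : ∀ x y : Fin 6 → ZMod p, x 0 = x 1 → x 2 = x 3 → key6 x ∈ E → y 0 = y 2 → key6 y ∈ E →
      ∃ i j : Fin 6, (x i, y i) ≠ (x j, y j) ∧ key6 (fun k => (y i - y j) * x k - (x i - x j) * y k) ∉ E)
    (h3c : ∀ x y : Fin 6 → ZMod p, x 0 = x 3 →
      (∀ a b : Fin 6, a ≠ b → x a = x b → (a = 0 ∧ b = 3) ∨ (a = 3 ∧ b = 0)) → key6 x ∈ E → y 0 = y 2 →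
      (∀ a b : Fin 6, a ≠ b → y a = y b → (a = 0 ∧ b = 2) ∨ (a = 2 ∧ b = 0)) → key6 y ∈ E →
      ∃ i j : Fin 6, (x i, y i) ≠ (x j, y j) ∧ key6 (fun k => (y i - y j) * x k - (x i - x j) * y k) ∉ E)
    (u : Fin 6 → ZMod p × ZMod p) :
    ∃ j < p + 1, ∃ σ : Equiv.Perm (Fin 6), lineDir p j (u (σ 0)) = lineDir p j (u (σ 1)) ∧
      key6 (fun i => lineDir p j (u (σ i))) ∉ E := by
  -- a functional collapsing two given points
  have collapse : ∀ a b : Fin 6, ∀ v : Fin 6 → ZMod p × ZMod p, v a ≠ v b →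
      let w := v a - v b
      (w.2 ≠ 0 ∨ -w.1 ≠ 0) ∧ lmap w.2 (-w.1) (v a) = lmap w.2 (-w.1) (v b) := by
    intro a b v hab
    refine ⟨?_, ?_⟩
    · by_contra h; push Not at h
      exact hab (sub_eq_zero.1 (Prod.ext (neg_eq_zero.1 h.2) h.1))
    · have : lmap (v a - v b).2 (-(v a - v b).1) (v a - v b) = 0 := by rw [lmap_apply]; ring
      rwa [map_sub, sub_eq_zero] at this
  by_cases hinj : Function.Injective u
  swap
  · -- a repeated point: relabel it to `0, 1`
    rw [Function.Injective] at hinj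
    push Not at hinj
    obtain ⟨i, i', e, hne⟩ := hinj
    obtain ⟨h0, h1⟩ := pairPerm6_apply i i' hne
    apply goal_of_perm_w (pairPerm6 i i')
    set v : Fin 6 → ZMod p × ZMod p := fun k => u (pairPerm6 i i' k) with hv
    have hv01 : v 0 = v 1 := by simp only [hv, h0, h1, e]
    show ∃ j < p + 1, ∃ σ : Equiv.Perm (Fin 6), lineDir p j (v (σ 0)) = lineDir p j (v (σ 1)) ∧
      key6 (fun i => lineDir p j (v (σ i))) ∉ E
    by_cases hv2 : v 2 = v 0
    · -- three coincident points: collapse the fourth ⇒ four equal values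
      obtain ⟨j, hj, e3⟩ := exists_lineDir_eq (v 0) (v 3)
      refine ⟨j, hj, 1, by simp [hv01], ?_⟩
      simp only [Equiv.Perm.coe_one, id_eq]
      exact key6_not_mem_of_four hE1 (fun k => lineDir p j (v k)) (i := 0) (j := 1) (k := 2) (l := 3) (by decide)
        (by decide) (by decide) (by decide) (by decide) (by decide) (by simp [hv01]) (by simp [hv2]) e3.symm
    · obtain ⟨hc, hcol⟩ := collapse 2 0 v hv2
      refine goodS_of_triple hE1 hE2 h3a v _ _ hc ?_ ?_
      · simp only [hv01]
      · rw [← hv01]; exact hcol.symm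
  -- distinct points: two parallel pairs, or the distinct-directions case
  by_cases hpp : ∃ q q' : {q : Fin 6 × Fin 6 // q.1 < q.2}, q ≠ q' ∧
      lmap (u q.1.1 - u q.1.2).2 (-(u q.1.1 - u q.1.2).1) (u q'.1.1 - u q'.1.2) = 0
  swap
  · push Not at hpp
    exact goodS_of_distinct hE2 h3c u hinj hpp
  obtain ⟨q, q', hqq, hpar⟩ := hpp
  obtain ⟨⟨i, j⟩, hij⟩ := q
  obtain ⟨⟨k, l⟩, hkl⟩ := q'
  simp only at hij hkl hpar hqq
  have hne : (i, j) ≠ (k, l) := fun h => hqq (Subtype.ext h)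
  have huij : u i ≠ u j := fun h => (ne_of_lt hij) (hinj h)
  obtain ⟨hc, hcol⟩ := collapse i j u huij
  -- `x`-values: `x i = x j` and `x k = x l`
  have hkl' : lmap (u i - u j).2 (-(u i - u j).1) (u k) = lmap (u i - u j).2 (-(u i - u j).1) (u l) := by
    rwa [map_sub, sub_eq_zero] at hpar
  set c₁ := (u i - u j).2 with hc₁
  set c₂ := -(u i - u j).1 with hc₂
  rcases pairs_overlap_w i j k l hij hkl hne with ⟨hik, hil, hjk, hjl⟩ | hjk | hik | hil | hjl
  · -- disjoint pairs
    obtain ⟨e0, e1, e2, e3⟩ := quadPerm_apply i j k l (ne_of_lt hij) hik hil hjk hjl (ne_of_lt hkl)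
    apply goal_of_perm_w (quadPerm i j k l)
    refine goodS_of_twopairs hE1 hE2 h3b (fun m => u (quadPerm i j k l m)) c₁ c₂ hc ?_ ?_
    · show lmap c₁ c₂ (u (quadPerm i j k l 0)) = lmap c₁ c₂ (u (quadPerm i j k l 1)); rw [e0, e1]; exact hcol
    · show lmap c₁ c₂ (u (quadPerm i j k l 2)) = lmap c₁ c₂ (u (quadPerm i j k l 3)); rw [e2, e3]; exact hkl'
  · -- j = k: triple i, j, l
    subst hjk
    obtain ⟨e0, e1, e2⟩ := triPerm_apply i j l (ne_of_lt hij) (ne_of_lt (lt_trans hij hkl)) (ne_of_lt hkl)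
    apply goal_of_perm_w (triPerm i j l)
    refine goodS_of_triple hE1 hE2 h3a (fun m => u (triPerm i j l m)) c₁ c₂ hc ?_ ?_
    · show lmap c₁ c₂ (u (triPerm i j l 0)) = lmap c₁ c₂ (u (triPerm i j l 1)); rw [e0, e1]; exact hcol
    · show lmap c₁ c₂ (u (triPerm i j l 1)) = lmap c₁ c₂ (u (triPerm i j l 2)); rw [e1, e2]; exact hkl'
  · -- i = k: triple j, i, l
    subst hik
    have hjl : j ≠ l := fun h => hne (by rw [h])
    obtain ⟨e0, e1, e2⟩ := triPerm_apply j i l (ne_of_lt hij).symm hjl (ne_of_lt hkl)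
    apply goal_of_perm_w (triPerm j i l)
    refine goodS_of_triple hE1 hE2 h3a (fun m => u (triPerm j i l m)) c₁ c₂ hc ?_ ?_
    · show lmap c₁ c₂ (u (triPerm j i l 0)) = lmap c₁ c₂ (u (triPerm j i l 1)); rw [e0, e1]; exact hcol.symm
    · show lmap c₁ c₂ (u (triPerm j i l 1)) = lmap c₁ c₂ (u (triPerm j i l 2)); rw [e1, e2]; exact hkl'
  · -- i = l: triple j, i, k
    subst hil
    obtain ⟨e0, e1, e2⟩ := triPerm_apply j i k (ne_of_lt hij).symm (ne_of_lt (lt_trans hkl hij)).symm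
      (ne_of_lt hkl).symm
    apply goal_of_perm_w (triPerm j i k)
    refine goodS_of_triple hE1 hE2 h3a (fun m => u (triPerm j i k m)) c₁ c₂ hc ?_ ?_
    · show lmap c₁ c₂ (u (triPerm j i k 0)) = lmap c₁ c₂ (u (triPerm j i k 1)); rw [e0, e1]; exact hcol.symm
    · show lmap c₁ c₂ (u (triPerm j i k 1)) = lmap c₁ c₂ (u (triPerm j i k 2)); rw [e1, e2]; exact hkl'.symm
  · -- j = l: triple i, j, k
    subst hjl
    have hik : i ≠ k := fun h => hne (by rw [h])
    obtain ⟨e0, e1, e2⟩ := triPerm_apply i j k (ne_of_lt hij) hik (ne_of_lt hkl).symm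
    apply goal_of_perm_w (triPerm i j k)
    refine goodS_of_triple hE1 hE2 h3a (fun m => u (triPerm i j k m)) c₁ c₂ hc ?_ ?_
    · show lmap c₁ c₂ (u (triPerm i j k 0)) = lmap c₁ c₂ (u (triPerm i j k 1)); rw [e0, e1]; exact hcol
    · show lmap c₁ c₂ (u (triPerm i j k 1)) = lmap c₁ c₂ (u (triPerm i j k 2)); rw [e1, e2]; exact hkl'.symm

end Core

end ZpZpDomino

end Summit.MatrixMultiplication.OmegaCensus
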